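import Literature.AlgebraicGeometry.Resolution.MonoidalSupportReduction
import Literature.AlgebraicGeometry.Resolution.Prop81HeadExtraction
import Literature.AlgebraicGeometry.Resolution.ArithmeticalThreefoldsMonomials
import HarnessLib

/-!
# [CoP1] Prop. 8.1 ⇒ head of Prop. 9.3: from the principalized stage `S₂` to the head

Topic: `Literature/AlgebraicGeometry/Resolution`. PROOF side of `CossartPiltant2019ReductionP`
(`ArithmeticalThreefoldsLocal.lean`), input (C4), [CoP1] Prop. 8.1 (V. Cossart, O. Piltant,
HAL hal-00139124, pp. 22–23). The printed proof of Prop. 8.1 has two halves: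

1. (HAL p. 22) a local uniformization `S₁ ⊇ S₀` (Cor. 4.6) and a principalization
   (Prop. 4.1): "`S₂` of `W/k` with r.s.p. `(y₁, y₂, y₃)` such that `S₁ < S₂`, `(S₁)_f = (S₂)_f`
   and each of the ideals `f S₂` and `m_{S₀} S₂` is monomial in `y₁, y₂, y₃`";
2. (HAL p. 23) the monoidal loops "`E = F`" and "`♯E ≤ r`" (Lemma 8.2).

This file PROVES the second half TOGETHER WITH the extraction of the head of Prop. 9.3
(`head_conclusion_of_principalized`): from the stage `S₂` — a regular `R_t = (S[t])_𝔪`,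
`t ⊆ K′`, with regular parameters `x`, a tracked element `F ∈ R₁′` (`Fⁿ t ⊆ R₁′`) which is a
unit times a monomial `u x^α`, a generator `h = w x^β` of `m_{R₁′} R_t` with
`∅ ≠ supp β ⊆ supp α`, elements `f₁, …, f_r ∈ M` of `R_t` dividing `F` with multiplicatively
independent values, and a supplier of relations among any `> r` values (rational rank `≤ r`) —
to the literal conclusion of `hHead` of
`cossartPiltant2019ReductionP_of_cjs_of_stableInertia_of_head`, by
`exists_frameStepsTracked_supp_eq_of_rankOne_subset`,
`exists_frameStepsTracked_card_supp_le_subset` and `head_conclusion_of_finalState`.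

What is NOT here: the first half (the principalization stage with controlled denominators,
`ModelDenominatorTracking.lean`) and the choice of the `fᵢ`.

Everything is PROVED; no named facts, definitions, instances or notation are introduced.

## Sources

* V. Cossart, O. Piltant, J. Algebra 320 (2008) 1051–1082: proof of Prop. 8.1 and of Prop. 9.3
  up to (47) (HAL hal-00139124, pp. 22–23, 27). [CossartPiltant2008]
-/

noncomputable section

namespace Literature.AlgebraicGeometry.Resolution

universe u

open IsLocalRing _root_.Polynomial Function

section Middle

variable {S : Type u} [CommRing S] [IsDomain S] [IsLocalRing S] {E : Type u} [Field E]
  [Algebra S E] [Algebra.IsAlgebraic S E]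
  (hSuc : IsUniversallyCatenaryRing S) (hinj : Function.Injective (algebraMap S E))
  (OE : ValuationSubring E) (hSO : ∀ s : S, algebraMap S E s ∈ OE)
  (hdom : ∀ s ∈ maximalIdeal S, OE.valuation (algebraMap S E s) < 1)
  (hres : ∀ y : OE, ∃ q : S[X], (∃ i, q.coeff i ∉ maximalIdeal S) ∧
    OE.valuation (q.eval₂ (algebraMap S E) y) < 1)
  (hSdim : ringKrullDim S = (3 : ℕ)) (hrk : Nonempty OE.valuation.RankOne)

include hSuc hinj hSO hdom hres hSdim in
/-- In the frame (`d = 3`): if a member `x_c` of a regular system of parameters of `R_t`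
divides the monomial `u ∏ x^{α}` (`v(u) = 0`), then `α_c > 0` (the `x_c` are pairwise
non-associate primes). [cite: Matsumura1987, Thm. 14.2 and 14.3] -/
theorem pos_of_rsop_dvd_monomial (t : Set E) (ht : t.Finite)
    (hTO : (Algebra.adjoin S t).toSubring ≤ OE.toSubring)
    (hreg : IsRegularLocalRing (locAtCentre (Algebra.adjoin S t).toSubring OE))
    (x : Fin 3 → locAtCentre (Algebra.adjoin S t).toSubring OE)
    (hx : haveI := isLocalRing_locAtCentre hTO
      Ideal.span (Set.range x) = maximalIdeal _)
    (u : locAtCentre (Algebra.adjoin S t).toSubring OE) (hvu : OE.valuation (u : E) = 1)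
    (α : Fin 3 → ℕ) (c : Fin 3) (hdvd : x c ∣ u * ∏ k, x k ^ α k) : 0 < α c := by
  classical
  haveI := isLocalRing_locAtCentre hTO
  haveI := hreg
  have hdimR : ringKrullDim (locAtCentre (Algebra.adjoin S t).toSubring OE) = (3 : ℕ) := by
    haveI : Algebra.FiniteType S (Algebra.adjoin S t) := by
      rw [← ht.coe_toFinset]
      exact (Subalgebra.fg_iff_finiteType _).mp (Subalgebra.fg_adjoin_finset _)
    rw [ringKrullDim_locAtCentre_eq_of_frame hSuc hinj OE hSO hdom hres (Algebra.adjoin S t) hTO,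
      hSdim]
  have hd : (maximalIdeal (locAtCentre (Algebra.adjoin S t).toSubring OE)).spanFinrank = 3 := by
    have h := IsRegularLocalRing.spanFinrank_maximalIdeal
      (R := locAtCentre (Algebra.adjoin S t).toSubring OE)
    rw [hdimR] at h
    exact_mod_cast h
  -- `x_c` is prime
  have hprime : Prime (x c) := by
    have h := isPrime_span_image hd x hx {c}
    rw [Finset.coe_singleton, Set.image_singleton] at h
    refine (Ideal.span_singleton_prime ?_).mp h
    intro h0
    have := not_mem_span_image_of_not_mem hd x hx (S := ∅) (i := c) (Set.notMem_empty c)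
    apply this
    rw [h0]
    exact Ideal.zero_mem _
  -- `u` is a unit
  have hunit : IsUnit u := by
    by_contra hnu
    have := (not_isUnit_locAtCentre_iff hTO u).mp hnu
    rw [hvu] at this
    exact lt_irrefl _ this
  have h1 : x c ∣ ∏ k, x k ^ α k := (hprime.dvd_or_dvd hdvd).resolve_left
    (fun h => hprime.not_unit (isUnit_of_dvd_unit h hunit))
  obtain ⟨k, -, hk⟩ := hprime.exists_mem_finset_dvd h1
  have hck : x c ∣ x k := hprime.dvd_of_dvd_pow hk
  by_cases hkc : k = c
  · subst hkc
    by_contra h0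
    have hα0 : α k = 0 := Nat.eq_zero_of_not_pos h0
    rw [hα0, pow_zero] at hk
    exact hprime.not_unit (isUnit_of_dvd_one hk)
  · exfalso
    have := not_mem_span_image_of_not_mem hd x hx (S := {c}) (i := k) (by simpa using hkc)
    apply this
    rw [Set.image_singleton]
    exact Ideal.mem_span_singleton.mpr hck

set_option maxHeartbeats 1600000 in
include hSuc hinj hSO hdom hres hSdim hrk in
/-- **[CoP1] Prop. 8.1, second half, and the head of Prop. 9.3.** From the principalized
stage `S₂` (see the module docstring) to the literal conclusion of `hHead`: the loops `E = F`
and `♯E ≤ r` by monoidal transforms along the valuation (tracked, confined to `K′`), then the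
extraction `head_conclusion_of_finalState`.
[cite: CossartPiltant2008, proof of Prop. 8.1 (HAL pp. 22–23) and of Prop. 9.3 (p. 27)] -/
theorem head_conclusion_of_principalized (A : Subring E) (hSA : ∀ s : S, algebraMap S E s ∈ A)
    (M K' : Subfield E) (hSK : ∀ s : S, algebraMap S E s ∈ K') (B₀ : Subalgebra S E)
    (t : Set E) (ht : t.Finite) (htK : t ⊆ K')
    (hTO : (Algebra.adjoin S t).toSubring ≤ OE.toSubring) (hB₀ : B₀ ≤ Algebra.adjoin S t)
    (hreg : IsRegularLocalRing (locAtCentre (Algebra.adjoin S t).toSubring OE))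
    (x : Fin 3 → locAtCentre (Algebra.adjoin S t).toSubring OE)
    (hx : haveI := isLocalRing_locAtCentre hTO
      Ideal.span (Set.range x) = maximalIdeal _)
    (F u : E) (hFA : F ∈ A) (huR : u ∈ locAtCentre (Algebra.adjoin S t).toSubring OE)
    (hvu : OE.valuation u = 1) (α : Fin 3 → ℕ) (hF : F = u * ∏ c, (x c : E) ^ α c)
    (hTR : ∀ z ∈ t, ∃ n : ℕ, F ^ n * z ∈ A)
    (h w : E) (hwR : w ∈ locAtCentre (Algebra.adjoin S t).toSubring OE)
    (hvw : OE.valuation w = 1) (β : Fin 3 → ℕ) (hh : h = w * ∏ c, (x c : E) ^ β c)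
    (hβα : ∀ c, 0 < β c → 0 < α c) (hβne : ∃ c, 0 < β c)
    (hdomA : ∀ y ∈ A, OE.valuation y < 1 →
      ∃ c ∈ locAtCentre (Algebra.adjoin S t).toSubring OE, y = h * c)
    (r : ℕ) (hr0 : 0 < r)
    (hdep : ∀ (I : Finset (Fin 3)) (y : Fin 3 → E), r < I.card → (∀ k, y k ≠ 0) →
      ∃ c : Fin 3 → ℤ, (∀ k, k ∉ I → c k = 0) ∧ c ≠ 0 ∧
        ∏ k, OE.valuation (y k) ^ (c k).toNat = ∏ k, OE.valuation (y k) ^ (-c k).toNat)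
    (f : Fin r → E) (hfM : ∀ i, f i ∈ M)
    (hfR : ∀ i, f i ∈ locAtCentre (Algebra.adjoin S t).toSubring OE)
    (hfdvd : ∀ i, ∃ c ∈ locAtCentre (Algebra.adjoin S t).toSubring OE, F = f i * c)
    (hind : ∀ p m : Fin r → ℕ, ∏ i, OE.valuation (f i) ^ p i = ∏ i, OE.valuation (f i) ^ m i →
      p = m) :
    ∃ (t'' : Finset E) (_ : (t'' : Set E) ⊆ K')
      (hTO' : (Algebra.adjoin S (t'' : Set E)).toSubring ≤ OE.toSubring)
      (_ : B₀ ≤ Algebra.adjoin S (t'' : Set E))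
      (_ : IsRegularLocalRing (locAtCentre (Algebra.adjoin S (t'' : Set E)).toSubring OE))
      (r' : ℕ) (hr' : r' ≤ 3) (_ : 0 < r')
      (x' : Fin 3 → locAtCentre (Algebra.adjoin S (t'' : Set E)).toSubring OE),
      (∀ j, ((x' j : locAtCentre (Algebra.adjoin S (t'' : Set E)).toSubring OE) : E) ≠ 0) ∧
      (haveI := isLocalRing_locAtCentre hTO'
       Ideal.span (Set.range x') =
         maximalIdeal (locAtCentre (Algebra.adjoin S (t'' : Set E)).toSubring OE)) ∧
      (∀ y : locAtCentre (Algebra.adjoin S (t'' : Set E)).toSubring OE,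
        (y : E) ∈ A → OE.valuation (y : E) < 1 →
        y ∈ Ideal.span {∏ i : Fin r', x' (Fin.castLE hr' i)}) ∧
      (∃ (f' : Fin r' → E)
          (γ' : Fin r' → (locAtCentre (Algebra.adjoin S (t'' : Set E)).toSubring OE)ˣ)
          (a' : Matrix (Fin r') (Fin r') ℕ),
        (∀ i, f' i ∈ M) ∧
        (∀ i, f' i = ((γ' i : locAtCentre (Algebra.adjoin S (t'' : Set E)).toSubring OE) : E) *
          ∏ j, ((x' (Fin.castLE hr' j) :
            locAtCentre (Algebra.adjoin S (t'' : Set E)).toSubring OE) : E) ^ a' i j) ∧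
        (a'.map (fun n : ℕ => (n : ℤ))).det ≠ 0) ∧
      (∃ (f₁ : E) (w' : (locAtCentre (Algebra.adjoin S (t'' : Set E)).toSubring OE)ˣ)
          (e : Fin r' → ℕ),
        f₁ ∈ A ∧
        f₁ = ((w' : locAtCentre (Algebra.adjoin S (t'' : Set E)).toSubring OE) : E) *
          ∏ i, ((x' (Fin.castLE hr' i) :
            locAtCentre (Algebra.adjoin S (t'' : Set E)).toSubring OE) : E) ^ e i ∧
        ∀ z ∈ (t'' : Set E), ∃ n : ℕ, f₁ ^ n * z ∈ A) := by
  classical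
  -- the loop `E = F`
  obtain ⟨t₁, htt₁, ht₁, ht₁K, hTR₁, hT₁O, hreg₁, hsub₁, x₁, u₁, w₁, α₁, β₁, hspan₁, hu₁R, hvu₁,
    hw₁R, hvw₁, hF₁, hh₁, hEF₁⟩ :=
    exists_frameStepsTracked_supp_eq_of_rankOne_subset hSuc hinj OE hSO hdom hres hSdim A hSA F
      hFA K' hSK hrk t ht htK hTR hTO hreg x hx h u w huR hvu hwR hvw α β hF hh hβα hβne
  -- the loop `♯E ≤ r`
  have hcard₁ : (Finset.univ.filter (fun c => 0 < α₁ c)).card ≤ r + 3 := by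
    have := Finset.card_le_univ (Finset.univ.filter (fun c => 0 < α₁ c))
    rw [Fintype.card_fin] at this
    omega
  obtain ⟨t₂, ht₁t₂, ht₂, ht₂K, hTR₂, hT₂O, hreg₂, hsub₂, x₂, u₂, w₂, α₂, β₂, hspan₂, hu₂R, hvu₂,
    hw₂R, hvw₂, hF₂, hh₂, hEF₂, hcard₂⟩ :=
    exists_frameStepsTracked_card_supp_le_subset hSuc hinj OE hSO hdom hres hSdim A hSA F hFA K'
      hSK r hdep 3 t₁ ht₁ ht₁K hTR₁ hT₁O hreg₁ x₁ hspan₁ h u₁ w₁ hu₁R hvu₁ hw₁R hvw₁ α₁ β₁ hF₁ hh₁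
      hEF₁ hcard₁
  haveI := isLocalRing_locAtCentre hT₂O
  set E' : Finset (Fin 3) := Finset.univ.filter (fun c => 0 < α₂ c) with hE'def
  have hx₂0 : ∀ j, (x₂ j : E) ≠ 0 := fun j =>
    coe_rsop_ne_zero_of_frame hSuc hinj OE hSO hdom hres hSdim t₂ ht₂ hT₂O hreg₂ x₂ hspan₂ j
  -- the `fᵢ` are monomials supported in `E′` in the final parameters
  have hu₂inv : u₂⁻¹ ∈ locAtCentre (Algebra.adjoin S t₂).toSubring OE := inv_mem_locAtCentre hu₂R hvu₂
  have hfmono : ∀ i, ∃ (γ : E) (a : Fin 3 → ℕ),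
      γ ∈ locAtCentre (Algebra.adjoin S t₂).toSubring OE ∧ OE.valuation γ = 1 ∧
      (∀ c, c ∉ E' → a c = 0) ∧ f i = γ * ∏ c, (x₂ c : E) ^ a c := by
    intro i
    obtain ⟨cᵢ, hcᵢ, hFc⟩ := hfdvd i
    have hfR₂ : f i ∈ locAtCentre (Algebra.adjoin S t₂).toSubring OE := hsub₂ (hsub₁ (hfR i))
    have hcR₂ : cᵢ ∈ locAtCentre (Algebra.adjoin S t₂).toSubring OE := hsub₂ (hsub₁ hcᵢ)
    -- `f i ∣ u₂ ∏ x₂^{α₂}` in the local ring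
    have hdvd : (⟨f i, hfR₂⟩ : locAtCentre (Algebra.adjoin S t₂).toSubring OE) ∣
        ∏ c, x₂ c ^ α₂ c := by
      refine ⟨⟨cᵢ, hcR₂⟩ * ⟨u₂⁻¹, hu₂inv⟩, Subtype.ext ?_⟩
      simp only [Subring.coe_mul, SubmonoidClass.coe_finsetProd, SubmonoidClass.coe_pow]
      have hu₂0 : u₂ ≠ 0 := ne_zero_of_valuation_eq_one hvu₂
      rw [show (∏ c, (x₂ c : E) ^ α₂ c) = u₂⁻¹ * F by rw [hF₂]; field_simp, hFc]
      ring
    haveI := hreg₂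
    have hdimR : ringKrullDim (locAtCentre (Algebra.adjoin S t₂).toSubring OE) = (3 : ℕ) := by
      haveI : Algebra.FiniteType S (Algebra.adjoin S t₂) := by
        rw [← ht₂.coe_toFinset]
        exact (Subalgebra.fg_iff_finiteType _).mp (Subalgebra.fg_adjoin_finset _)
      rw [ringKrullDim_locAtCentre_eq_of_frame hSuc hinj OE hSO hdom hres (Algebra.adjoin S t₂)
        hT₂O, hSdim]
    have hd : (maximalIdeal (locAtCentre (Algebra.adjoin S t₂).toSubring OE)).spanFinrank = 3 := by
      have h := IsRegularLocalRing.spanFinrank_maximalIdeal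
        (R := locAtCentre (Algebra.adjoin S t₂).toSubring OE)
      rw [hdimR] at h
      exact_mod_cast h
    have hprime : ∀ c, Prime (x₂ c) := by
      intro c
      have h := isPrime_span_image hd x₂ hspan₂ {c}
      rw [Finset.coe_singleton, Set.image_singleton] at h
      refine (Ideal.span_singleton_prime ?_).mp h
      intro h0
      exact hx₂0 c (by rw [h0]; rfl)
    haveI : IsDomain (locAtCentre (Algebra.adjoin S t₂).toSubring OE) := inferInstance
    obtain ⟨γu, a, hγa⟩ :=
      CossartPiltantMonomial.exists_eq_units_mul_prod_pow_of_dvd hprime α₂ hdvd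
    have hγval : OE.valuation ((γu : locAtCentre (Algebra.adjoin S t₂).toSubring OE) : E) = 1 := by
      have hle : OE.valuation ((γu : locAtCentre (Algebra.adjoin S t₂).toSubring OE) : E) ≤ 1 :=
        (OE.valuation_le_one_iff _).mpr (locAtCentre_le hT₂O γu.val.2)
      have hnlt : ¬ OE.valuation ((γu : locAtCentre (Algebra.adjoin S t₂).toSubring OE) : E) < 1 :=
        fun hlt => ((not_isUnit_locAtCentre_iff hT₂O _).mpr hlt) γu.isUnit
      exact le_antisymm hle (not_lt.mp hnlt)
    refine ⟨(γu : locAtCentre (Algebra.adjoin S t₂).toSubring OE), a, γu.val.2,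
      hγval, fun c hc => ?_, ?_⟩
    · -- support: `x₂ c ∣ f i ∣ F = u₂ x₂^{α₂}` forces `α₂ c > 0`
      by_contra ha0
      have hac : 0 < a c := Nat.pos_of_ne_zero ha0
      have hxdvdf : x₂ c ∣ (⟨f i, hfR₂⟩ : locAtCentre (Algebra.adjoin S t₂).toSubring OE) := by
        rw [hγa]
        refine Dvd.dvd.mul_left ?_ _
        exact (dvd_pow_self (x₂ c) hac.ne').trans (Finset.dvd_prod_of_mem _ (Finset.mem_univ c))
      have hxdvdF : x₂ c ∣ ⟨u₂, hu₂R⟩ * ∏ k, x₂ k ^ α₂ k := by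
        have hFR₂ : (⟨f i, hfR₂⟩ : locAtCentre (Algebra.adjoin S t₂).toSubring OE) ∣
            ⟨u₂, hu₂R⟩ * ∏ k, x₂ k ^ α₂ k := by
          refine ⟨⟨cᵢ, hcR₂⟩, Subtype.ext ?_⟩
          simp only [Subring.coe_mul, SubmonoidClass.coe_finsetProd, SubmonoidClass.coe_pow]
          rw [← hF₂, hFc]
        exact hxdvdf.trans hFR₂
      have hpos := pos_of_rsop_dvd_monomial hSuc hinj OE hSO hdom hres hSdim t₂ ht₂ hT₂O hreg₂ x₂
        hspan₂ ⟨u₂, hu₂R⟩ hvu₂ α₂ c hxdvdF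
      exact hc (Finset.mem_filter.mpr ⟨Finset.mem_univ _, hpos⟩)
    · have := congrArg Subtype.val hγa
      simpa only [Subring.coe_mul, SubmonoidClass.coe_finsetProd, SubmonoidClass.coe_pow] using this
  choose γ a hγR hvγ hsuppa hfa using hfmono
  -- extraction
  exact head_conclusion_of_finalState OE M K' A B₀ t₂ ht₂ ht₂K hT₂O
    (hB₀.trans (Algebra.adjoin_mono (htt₁.trans ht₁t₂))) hreg₂ x₂ hx₂0 hspan₂ E' r hr0 hcard₂ F u₂
    hFA hu₂R hvu₂ α₂ (fun c hc => Nat.eq_zero_of_not_pos fun hp =>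
      hc (Finset.mem_filter.mpr ⟨Finset.mem_univ _, hp⟩)) hF₂ hTR₂ h w₂ hw₂R β₂
    (fun c hc => (hEF₂ c).mp (Finset.mem_filter.mp hc).2) hh₂
    (fun y hy hvy => by
      obtain ⟨c, hc, hyc⟩ := hdomA y hy hvy
      exact ⟨c, hsub₂ (hsub₁ hc), hyc⟩)
    f γ hfM hγR hvγ a hsuppa hfa hind

end Middle

end Literature.AlgebraicGeometry.Resolution

end
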